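import Summits.AtomisticToContinuum.HydrodynamicLimit.Theorems.CollisionIsometryCLTMacroClosureBlockMGFTwoScale
import Summits.AtomisticToContinuum.HydrodynamicLimit.Theorems.CollisionIsometryCLTMacroClosureEngineTwoScale
import Summits.AtomisticToContinuum.HydrodynamicLimit.Theorems.CollisionIsometryCLTMacroClosureClausiusTwoScale
import Summits.AtomisticToContinuum.HydrodynamicLimit.Theorems.CollisionIsometryCLTMacroClosureUniformDock
import Summits.AtomisticToContinuum.HydrodynamicLimit.Theorems.CollisionIsometryCLTMacroClosureStubThermo
import Summits.AtomisticToContinuum.HydrodynamicLimit.Theorems.CollisionIsometryCLTMacroClosureStubInitialEntropy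
import Summits.AtomisticToContinuum.HydrodynamicLimit.Theorems.CollisionIsometryCLTMacroClosureRuelleConvexity
import HarnessLib

/-!
# `MacroClosureInBand` — the macroscopic closure interface of route `CollisionIsometryCLT` on UNIFORM kinetic
inputs — PROVED (line `IdeatorTwoGen1Sketch`, crux `MacroClosure`, stmt-AtomisticToContinuum-14870)

Proof file (`--supports stmt-AtomisticToContinuum-14870`) of the line lead (continuation c2). The crux AS TYPED,
`MacroClosure := CollisionalTransferLocality → AprioriBoundsPreShock → FastMomentRelaxationPreShock → HydrodynamicLimit`,
carries its dilute level AFTER the profiles while the re-typed conjunct wants it BEFORE them (STRATEGY-CENSUS of the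
crux dossier); the strategist's split child 3, `UniformDock.MacroClosureInBand := CollisionalTransferLocality →
AprioriBoundsInBand → FastMomentRelaxationInBand → HydrodynamicLimit` (landed statement, `…UniformDock.lean`), is the
part of the crux that is mathematics rather than quantifier order. THIS FILE PROVES IT OUTRIGHT (no hypotheses, no
`DiluteSelfConsistency`): thermodynamics (`stub_thermo`), Ruelle convexity (`stub_hsFreeEnergyConvex`, 9526 closed),
the initial entropy value (`stub_initialEntropy`), the TWO-SCALE homogeneous block MGF for the box-smoothed / fine
mollifier pair (`stub_blockMGF_twoScale`), two-scale Clausius in mean (`stub_clausius_twoScale`) and the two-scale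
pointwise barycentric engine (`stub_engine_twoScale`), docked with `η₀ := min η₃ (min η₁ᴬ η₁ᶠ)/2` chosen before the
profiles — the conjunct's guard supplying the chamber and the dilute provisos, `AprioriBoundsInBand (ii)` supplying
the bands of BOTH kernel families. Consequently the crux as typed holds modulo the two uniform kinetic inputs
(`macroClosure_of_uniformInputs`, = the skeleton's `stub_uniformKineticInputs`: stmt-17749 and the in-band hinge).
-/

noncomputable section

open MeasureTheory Filter Set Topology InformationTheory
open scoped ENNReal ContDiff

namespace Summit.AtomisticToContinuum.HydrodynamicLimit.Theorems.MacroClosureLine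

open Literature.MathematicalPhysics.KineticTheory Literature.Analysis.FluidPDE
open Literature.Analysis.FunctionSpaces
open Summit.AtomisticToContinuum.HydrodynamicLimit.Theses
open Summit.AtomisticToContinuum.HydrodynamicLimit.Theses.CollisionIsometryCLT

namespace Barycentric

/-- **Uniform two-scale threshold bookkeeping** (the skeleton's `hydrodynamicLimit_of_pointwise_twoScale`, with the
landed two-scale engine): the UNIFORM a-priori bounds (at both families), the UNIFORM hinge, collisional transfer
locality and two-scale Clausius in mean for one pair of admissible families give the packing-guarded conjunct.
[folklore] -/
theorem hydrodynamicLimit_of_twoScale (η₃ : ℝ) (hη₃ : 0 < η₃) (hT : ThermoChamber η₃)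
    (hH : StiffCollisionalRelaxation.HsFreeEnergyConvex)
    (γ C : ℝ) (φ : ℕ → T3 → ℝ) (hγ : 0 < γ) (hγ' : γ ≤ 1 / 15) (hφ : AdmissibleKernel γ C φ)
    (γ₂ C₂ : ℝ) (φ₂ : ℕ → T3 → ℝ) (hγ₂ : 0 < γ₂) (hγ₂' : γ₂ ≤ 1 / 15) (hφ₂ : AdmissibleKernel γ₂ C₂ φ₂)
    (hCl : ∀ (a₀ θ₀ : T3 → ℝ) (u₀ : T3 → V3), Continuous a₀ → Continuous θ₀ → Continuous u₀ →
      (∀ x, 0 < a₀ x) → (∀ x, 0 < θ₀ x) →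
      ∃ σ₀ : ℝ, 0 < σ₀ ∧ ∀ σ : ℝ, 0 < σ → σ < σ₀ →
      ∀ (T : ℝ) (ρ θ : ℝ → T3 → ℝ) (u : ℝ → T3 → V3), IsHardSphereEulerSolution σ T ρ u θ →
        ∀ Φ : (N : ℕ) → Flow σ N,
          TendstoHydroFieldsAt (fun N => localGibbsLaw σ a₀ u₀ θ₀ N (Φ N)) Φ ρ u θ 0 →
          0 < γ → γ ≤ 1 / 15 → AdmissibleKernel γ C φ → 0 < γ₂ → γ₂ ≤ 1 / 15 → AdmissibleKernel γ₂ C₂ φ₂ →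
          ∀ (c₁ c₂ t₁ : ℝ), 0 < c₁ → 0 < c₂ → 0 < t₁ → t₁ < T →
          ∀ G : (N : ℕ) → Set (Config (N + 1) (Fin 3) T3), (∀ N, MeasurableSet (G N)) →
            (∀ N, G N ⊆ (Φ N).good) →
            (∀ N, ∀ z ∈ G N, ∀ s ∈ Icc 0 t₁, ∀ x,
                c₁ ≤ bρ (φ N) ((Φ N).flow s z) x ∧ bρ (φ N) ((Φ N).flow s z) x * σ ^ 3 ≤ 1) →
            (∀ N, ∀ z ∈ G N, ∀ s ∈ Icc 0 t₁, ∀ x,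
                c₂ ≤ bρ (φ₂ N) ((Φ N).flow s z) x ∧ bρ (φ₂ N) ((Φ N).flow s z) x * σ ^ 3 ≤ 1) →
            Tendsto (fun N => localGibbsLaw σ a₀ u₀ θ₀ N (Φ N) (G N)ᶜ) atTop (𝓝 0) →
            ∀ δ : ℝ, 0 < δ → ∀ᶠ N : ℕ in atTop, ∀ s ∈ Icc 0 t₁,
              Integrable (fun z => (G N).indicator
                  (fun z => ∫ x, hsEntropy σ (bU (φ N) ((Φ N).flow s z) x)) z)
                (localGibbsLaw σ a₀ u₀ θ₀ N (Φ N)) ∧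
              ∫ z, (G N).indicator (fun z => ∫ x, hsEntropy σ (bU (φ N) ((Φ N).flow s z) x)) z
                  ∂(localGibbsLaw σ a₀ u₀ θ₀ N (Φ N)) ≤
                (∫ x, hsEntropy σ (stateOf (ρ 0 x) (u 0 x) (θ 0 x))) + δ)
    (hC : CollisionalTransferLocality) (hA : UniformDock.AprioriBoundsInBand) (hF : UniformDock.FastMomentRelaxationInBand) :
    _root_.HydrodynamicLimit := by
  obtain ⟨ηA, hηA, HA0⟩ := hA
  obtain ⟨ηF, hηF, HF0⟩ := hF
  refine ⟨min η₃ (min ηA ηF) / 2, by positivity, ?_⟩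
  intro a₀ θ₀ u₀ ha hθ hu ha0 hθ0
  obtain ⟨σC, hσC, HC⟩ := hC a₀ θ₀ u₀ ha hθ hu ha0 hθ0
  obtain ⟨σA, hσA, HA⟩ := HA0 a₀ θ₀ u₀ ha hθ hu ha0 hθ0
  obtain ⟨σF, hσF, HF⟩ := HF0 a₀ θ₀ u₀ ha hθ hu ha0 hθ0
  obtain ⟨σL, hσL, HL⟩ := hCl a₀ θ₀ u₀ ha hθ hu ha0 hθ0
  refine ⟨min (1 / 2) (min σC (min σA (min σF σL))),
    lt_min one_half_pos (lt_min hσC (lt_min hσA (lt_min hσF hσL))), ?_⟩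
  intro σ hσ hσlt T ρ θ u hsol hguard Φ h0 t ht
  have hσ2 : σ < 2⁻¹ := by
    have := lt_of_lt_of_le hσlt (min_le_left _ _); norm_num at this ⊢; linarith
  have hσC' : σ < σC := lt_of_lt_of_le hσlt ((min_le_right _ _).trans (min_le_left _ _))
  have hσA' : σ < σA :=
    lt_of_lt_of_le hσlt ((min_le_right _ _).trans ((min_le_right _ _).trans (min_le_left _ _)))
  have hσF' : σ < σF := lt_of_lt_of_le hσlt
    ((min_le_right _ _).trans ((min_le_right _ _).trans ((min_le_right _ _).trans (min_le_left _ _))))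
  have hσL' : σ < σL := lt_of_lt_of_le hσlt
    ((min_le_right _ _).trans ((min_le_right _ _).trans ((min_le_right _ _).trans (min_le_right _ _))))
  rcases (eq_or_lt_of_le ht.1) with h | htpos
  · subst h; exact h0
  have htT : t < T := ht.2
  have hσ3 : 0 < σ ^ 3 := pow_pos hσ 3
  have hch : ∀ s ∈ Ico 0 T, ∀ x, ρ s x * σ ^ 3 < η₃ := fun s hs x =>
    (hguard s hs x).trans_le ((half_le_self (by positivity)).trans (min_le_left _ _))
  have hprovA : ∀ s ∈ Icc 0 t, ∀ x, 2 * ρ s x * σ ^ 3 < ηA := by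
    intro s hs x
    have h1 := hguard s ⟨hs.1, hs.2.trans_lt htT⟩ x
    have h2 : min η₃ (min ηA ηF) / 2 ≤ ηA / 2 := by
      gcongr; exact (min_le_right _ _).trans (min_le_left _ _)
    linarith
  have hprovF : ∀ s ∈ Icc 0 t, ∀ x, 2 * ρ s x * σ ^ 3 < ηF := by
    intro s hs x
    have h1 := hguard s ⟨hs.1, hs.2.trans_lt htT⟩ x
    have h2 : min η₃ (min ηA ηF) / 2 ≤ ηF / 2 := by
      gcongr; exact (min_le_right _ _).trans (min_le_right _ _)
    linarith
  have hA' := HA σ hσ hσA' T ρ θ u hsol Φ h0 t htpos htT hprovA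
  have hF' := HF σ hσ hσF' T ρ θ u hsol Φ h0 γ C φ hγ hγ' hφ t htpos htT hprovF
  have hθinv : Torus.IsSmoothSpaceTimeOn (Ico 0 T) (fun s x => (θ s x)⁻¹) :=
    ContDiffOn.inv hsol.smooth_temperature fun p hp =>
      (hsol.temperature_pos p.1 (mem_prod.1 hp).1 (Torus.proj p.2)).ne'
  have hlamM : Torus.IsSmoothSpaceTimeOn (Icc 0 t) (lamM θ u) :=
    (hθinv.smul hsol.smooth_velocity).mono (Icc_subset_Ico_right htT)
  have hlamE : Torus.IsSmoothSpaceTimeOn (Icc 0 t) (lamE θ) :=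
    hθinv.neg.mono (Icc_subset_Ico_right htT)
  have hC' := HC σ hσ hσC' Φ γ C φ hγ hγ' hφ t htpos (lamM θ u) (lamE θ) hlamM hlamE
  have hCl' := HL σ hσ hσL' T ρ θ u hsol Φ h0 hγ hγ' hφ hγ₂ hγ₂' hφ₂
  refine stub_engine_twoScale σ hσ hσ2 hH a₀ θ₀ u₀ ha hθ hu ha0 hθ0 T ρ θ u hsol η₃ hT hch Φ h0 γ C φ hγ
    hγ' hφ φ₂ t htpos htT hA'.1 (hA'.2 γ C φ hγ hγ' hφ) (hA'.2 γ₂ C₂ φ₂ hγ₂ hγ₂' hφ₂) hF' hC' ?_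
  intro c₁ hc₁ c₂ hc₂ G hGm hGg hGb hGb₂ hGc
  exact hCl' c₁ c₂ t hc₁ hc₂ htpos htT G hGm hGg hGb hGb₂ hGc

/-- **`MacroClosureInBand` PROVED** — the macroscopic closure interface of the route on UNIFORM kinetic inputs
(child 3 of the strategist's split of `MacroClosure`; no `DiluteSelfConsistency`, no named-fact hypothesis).
[cite: Dafermos2005, Thm 5.2.1] [cite: Ruelle1969, §3.4] -/
theorem macroClosureInBand_proof : UniformDock.MacroClosureInBand := by
  intro hC hA hF
  obtain ⟨η₃, hη₃, hT⟩ := stub_thermo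
  obtain ⟨γ, C, φ, γ₂, C₂, φ₂, hγ, hγ', hφ, hγ₂, hγ₂', hφ₂, hM⟩ := stub_blockMGF_twoScale
  have hCl := stub_clausius_twoScale stub_hsFreeEnergyConvex γ C φ γ₂ C₂ φ₂ hM stub_initialEntropy
  exact hydrodynamicLimit_of_twoScale η₃ hη₃ hT stub_hsFreeEnergyConvex γ C φ hγ hγ' hφ γ₂ C₂ φ₂
    hγ₂ hγ₂' hφ₂ hCl hC hA hF

/-- **The crux as typed, modulo the two uniform kinetic inputs** (the skeleton's `stub_uniformKineticInputs`:
stmt-17749 verbatim and the in-band pre-shock hinge). [folklore] -/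
theorem macroClosure_of_uniformInputs : UniformDock.AprioriBoundsInBand → UniformDock.FastMomentRelaxationInBand → MacroClosure :=
  fun hA hF => UniformDock.MacroClosure_of_subs hA hF macroClosureInBand_proof

end Barycentric

end Summit.AtomisticToContinuum.HydrodynamicLimit.Theorems.MacroClosureLine

end
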